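import Summits.CriticalPhenomena.PercolationContinuityZ3.Theorems.PercNearOneGluingNoHeavyQuantFarTwoAnchorReach
import Summits.CriticalPhenomena.PercolationContinuityZ3.Theorems.PercNearOneGluingNoHeavyQuantFarBlockLaw
import HarnessLib

/-!
# QUANT lane R8, front "FAR beyond trees", layer one — TWO-ANCHOR BLOCKS II: the internal law `X = I₁Y₁ + I₂Y₂` of a block whose relays hang
# at two anchors (independence of core and hairs; the formulas for `P(X ≥ 1)`, `P(X ≥ 2)`)

builds on p205010 (kernel theorem, internal audit signed; external expert review pending)

Support file (`--supports stmt-CriticalPhenomena-4575`), seat `prim-quant-p1` (gen 19); memo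
`run/shared/lean/prim/quant/prim-quant-p1-g19/FOR-LEAD-CACTI.md` §3 (kernel plan §5, file K5b).  Standard axioms; no sorries.

Setting of `…QuantFarTwoAnchorReach` (`Block.IsTwoAnchor c v₁ v₂ Z L par`): leaves `L ⊆ Z` pendant at the anchors `v₁, v₂`, block relays
`A ∩ Z ⊆ L`, `Aᵢ = {a ∈ A ∩ Z : par a = vᵢ}`.  Write `Eᵢ = {c ↔ vᵢ through the core}` (determined by the CORE pairs `Block.corePairs Z L`) and
`Yᵢ = #{ℓ ∈ Aᵢ : s(vᵢ, ℓ) open}` (determined by the HAIR pairs `Block.hairPairs vᵢ Aᵢ`); the three pair sets are pairwise disjoint, so under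
`prodBernoulli v` the core pattern, `Y₁` and `Y₂` are independent (`Block.real_core_hair_hair`).  For `v` vanishing on the non-parent pairs at the
leaves (a.s. leaf-good, `Block.real_congr_of_goodL`):

* `Block.real_one_le_X_eq` — `P(X ≥ 1) = P(E₁∖E₂)P(Y₁≥1) + P(E₂∖E₁)P(Y₂≥1) + P(E₁E₂)P(Y₁≥1) + P(E₁E₂)P(Y₁=0)P(Y₂≥1)`;
* `Block.real_two_le_X_eq` — `P(X ≥ 2) = P(E₁∖E₂)P(Y₁≥2) + P(E₂∖E₁)P(Y₂≥2) + P(E₁E₂)P(Y₁≥2) + P(E₁E₂)P(Y₁=1)P(Y₂≥1) + P(E₁E₂)P(Y₁=0)P(Y₂≥2)`;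
i.e. `h_S = m₁u₁ + m₂u₂ − p₁₁u₁u₂`, `t_S = m₁d₁ + m₂d₂ + p₁₁(s₁u₂ − u₁d₂)` of `…QuantFarTwoAnchorAlgebra` with `mᵢ = P(Eᵢ)`, `p₁₁ = P(E₁E₂)`.
[cite: Grimmett1999, §1.3 p. 10; §2.2] (product measure; events determined by finitely many coordinates); bookkeeping [this work].
-/

noncomputable section

namespace Summit.CriticalPhenomena.PercolationContinuityZ3.Theorems

namespace Quant

namespace Block

open Finset MeasureTheory Set
open Literature.Probability.LatticeModels
open Literature.Probability.Percolation
open scoped Classical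

variable {n : ℕ}

/-! ## Core pairs and hair pairs; determinacy; independence -/

/-- The core pairs: pairs meeting `Z` and avoiding the leaves `L`. [this work] -/
def corePairs (Z L : Finset (Fin n)) : Finset (Sym2 (Fin n)) :=
  Finset.univ.filter fun e => (∃ z ∈ Z, z ∈ e) ∧ ∀ ℓ ∈ L, ℓ ∉ e

/-- `core Z L ω` is `ω` restricted to the core pairs. [this work] -/
theorem core_eq_inter (Z L : Finset (Fin n)) (ω : BondConfig (Fin n)) : core Z L ω = ω ∩ ↑(corePairs Z L) := by
  ext e
  simp only [core, corePairs, Set.mem_setOf_eq, Set.mem_inter_iff, Finset.coe_filter, Finset.mem_univ, true_and]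

/-- Any event read off `core Z L` is determined by the core pairs. [this work] -/
theorem determinedBy_core (Z L : Finset (Fin n)) (P : BondConfig (Fin n) → Prop) :
    DeterminedBy {ω : BondConfig (Fin n) | P (core Z L ω)} (↑(corePairs Z L) : Set (Sym2 (Fin n))) := by
  rw [determinedBy_iff]
  intro ω ω' h
  simp only [mem_setOf_eq, core_eq_inter, h]

/-- The hair pairs of a set `B` of leaves hanging at `v`. [this work] -/
def hairPairs (v : Fin n) (B : Finset (Fin n)) : Finset (Sym2 (Fin n)) := B.image fun ℓ => s(v, ℓ)

/-- Any event read off the number of open hairs of `B` at `v` is determined by the hair pairs. [this work] -/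
theorem determinedBy_hair (v : Fin n) (B : Finset (Fin n)) (P : ℕ → Prop) :
    DeterminedBy {ω : BondConfig (Fin n) | P ((B.filter fun ℓ => s(v, ℓ) ∈ ω).card)} (↑(hairPairs v B) : Set (Sym2 (Fin n))) := by
  rw [determinedBy_iff]
  intro ω ω' h
  have key : (B.filter fun ℓ => s(v, ℓ) ∈ ω) = (B.filter fun ℓ => s(v, ℓ) ∈ ω') := by
    refine filter_congr fun ℓ hℓ => ?_
    have hmem : s(v, ℓ) ∈ (↑(hairPairs v B) : Set (Sym2 (Fin n))) := Finset.mem_coe.2 (mem_image_of_mem _ hℓ)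
    exact ⟨fun h1 => ((Set.ext_iff.1 h _).1 ⟨h1, hmem⟩).1, fun h1 => ((Set.ext_iff.1 h _).2 ⟨h1, hmem⟩).1⟩
  simp only [mem_setOf_eq, key]

/-- Hair pairs of leaves avoid the core pairs. [this work] -/
theorem disjoint_core_hair {Z L : Finset (Fin n)} (v : Fin n) {B : Finset (Fin n)} (hB : B ⊆ L) :
    Disjoint (corePairs Z L) (hairPairs v B) := by
  rw [Finset.disjoint_left]
  intro e he he'
  obtain ⟨ℓ, hℓ, rfl⟩ := mem_image.1 he'
  exact (mem_filter.1 he).2.2 ℓ (hB hℓ) (Sym2.mem_mk_right v ℓ)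

section TwoAnchor

variable {c v₁ v₂ : Fin n} {Z L : Finset (Fin n)} {par : Fin n → Fin n} (H : IsTwoAnchor c v₁ v₂ Z L par)
include H

/-- Hair pairs at the two anchors are disjoint. [this work] -/
theorem disjoint_hair_hair {B₁ B₂ : Finset (Fin n)} (hB₂ : B₂ ⊆ L) : Disjoint (hairPairs v₁ B₁) (hairPairs v₂ B₂) := by
  rw [Finset.disjoint_left]
  intro e he₁ he₂
  obtain ⟨ℓ, -, rfl⟩ := mem_image.1 he₁
  obtain ⟨ℓ', hℓ', he⟩ := mem_image.1 he₂
  rcases Sym2.eq_iff.1 he with ⟨h, -⟩ | ⟨-, h⟩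
  · exact H.hne h.symm
  · exact H.v₁L (h ▸ hB₂ hℓ')

/-- **Independence of core pattern and the two bundles.**  For `E` determined by the core pairs and `Fᵢ` determined by the hair pairs at `vᵢ`
(`Bᵢ ⊆ L`): `P(E ∩ F₁ ∩ F₂) = P(E)·P(F₁)·P(F₂)`. [this work] -/
theorem real_core_hair_hair (v : Sym2 (Fin n) → unitInterval) {B₁ B₂ : Finset (Fin n)} (hB₁ : B₁ ⊆ L) (hB₂ : B₂ ⊆ L)
    {E F₁ F₂ : Set (BondConfig (Fin n))} (hE : DeterminedBy E (↑(corePairs Z L) : Set (Sym2 (Fin n))))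
    (hF₁ : DeterminedBy F₁ (↑(hairPairs v₁ B₁) : Set (Sym2 (Fin n)))) (hF₂ : DeterminedBy F₂ (↑(hairPairs v₂ B₂) : Set (Sym2 (Fin n)))) :
    (prodBernoulli v).real (E ∩ F₁ ∩ F₂) = (prodBernoulli v).real E * (prodBernoulli v).real F₁ * (prodBernoulli v).real F₂ := by
  have hmeas : ∀ U : Set (BondConfig (Fin n)), MeasurableSet U := fun U => (Set.toFinite U).measurableSet
  have hsub₁ : (↑(hairPairs v₁ B₁) : Set (Sym2 (Fin n))) ⊆ (↑(corePairs Z L) : Set (Sym2 (Fin n)))ᶜ := by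
    intro e he hc
    exact Finset.disjoint_left.1 (disjoint_core_hair (Z := Z) v₁ hB₁) (Finset.mem_coe.1 hc) (Finset.mem_coe.1 he)
  have hsub₂ : (↑(hairPairs v₂ B₂) : Set (Sym2 (Fin n))) ⊆ (↑(corePairs Z L) : Set (Sym2 (Fin n)))ᶜ := by
    intro e he hc
    exact Finset.disjoint_left.1 (disjoint_core_hair (Z := Z) v₂ hB₂) (Finset.mem_coe.1 hc) (Finset.mem_coe.1 he)
  have hF : DeterminedBy (F₁ ∩ F₂) (↑(corePairs Z L) : Set (Sym2 (Fin n)))ᶜ := (hF₁.mono hsub₁).inter (hF₂.mono hsub₂)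
  rw [Set.inter_assoc, prodBernoulli_real_inter_of_determinedBy v (corePairs Z L) hE hF (hmeas _) (hmeas _),
    prodBernoulli_real_inter_of_determinedBy_disjoint v (disjoint_hair_hair H hB₂) hF₁ hF₂ (hmeas _) (hmeas _), mul_assoc]

omit H in
/-- Two-factor form: `P(E ∩ F₁) = P(E)·P(F₁)`. [this work] -/
theorem real_core_hair (v : Sym2 (Fin n) → unitInterval) {B₁ : Finset (Fin n)} (hB₁ : B₁ ⊆ L) (w₀ : Fin n)
    {E F₁ : Set (BondConfig (Fin n))} (hE : DeterminedBy E (↑(corePairs Z L) : Set (Sym2 (Fin n))))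
    (hF₁ : DeterminedBy F₁ (↑(hairPairs w₀ B₁) : Set (Sym2 (Fin n)))) :
    (prodBernoulli v).real (E ∩ F₁) = (prodBernoulli v).real E * (prodBernoulli v).real F₁ := by
  have hmeas : ∀ U : Set (BondConfig (Fin n)), MeasurableSet U := fun U => (Set.toFinite U).measurableSet
  have hsub₁ : (↑(hairPairs w₀ B₁) : Set (Sym2 (Fin n))) ⊆ (↑(corePairs Z L) : Set (Sym2 (Fin n)))ᶜ := by
    intro e he hc
    exact Finset.disjoint_left.1 (disjoint_core_hair (Z := Z) w₀ hB₁) (Finset.mem_coe.1 hc) (Finset.mem_coe.1 he)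
  exact prodBernoulli_real_inter_of_determinedBy v (corePairs Z L) hE (hF₁.mono hsub₁) (hmeas _) (hmeas _)

/-! ## Almost-sure leaf-goodness -/

omit H in
/-- If `v` vanishes on every pair at a leaf other than the pair to its parent, the configuration is almost surely leaf-good. [this work] -/
theorem real_congr_of_goodL (v : Sym2 (Fin n) → unitInterval)
    (hv : ∀ ℓ ∈ L, ∀ x : Fin n, x ≠ ℓ → x ≠ par ℓ → (v s(ℓ, x) : ℝ) = 0)
    (S T : Set (BondConfig (Fin n))) (hST : ∀ ω, GoodL L par ω → (ω ∈ S ↔ ω ∈ T)) :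
    (prodBernoulli v).real S = (prodBernoulli v).real T := by
  set μ := prodBernoulli v with hμ
  set Bd : Finset (Sym2 (Fin n)) := Finset.univ.filter fun e =>
    ∃ ℓ x : Fin n, ℓ ∈ L ∧ x ≠ ℓ ∧ x ≠ par ℓ ∧ e = s(ℓ, x) with hBd
  set Nbad : Set (BondConfig (Fin n)) := {ω | ∃ e ∈ Bd, e ∈ ω} with hN
  have hmeas : ∀ U : Set (BondConfig (Fin n)), MeasurableSet U := fun U => (Set.toFinite U).measurableSet
  have hN0 : μ.real Nbad = 0 := by
    have h0 : μ Nbad = 0 := by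
      apply prodBernoulli_setOf_exists_mem_eq_zero
      intro e he
      obtain ⟨ℓ, x, hℓ, hxℓ, hxp, rfl⟩ := (Finset.mem_filter.1 he).2
      exact hv ℓ hℓ x hxℓ hxp
    simp [measureReal_def, h0]
  have hgood : ∀ ω : BondConfig (Fin n), ω ∉ Nbad → GoodL L par ω := by
    intro ω hω ℓ hℓ x hxℓ he
    by_contra hxp
    exact hω ⟨s(ℓ, x), Finset.mem_filter.2 ⟨Finset.mem_univ _, ℓ, x, hℓ, hxℓ, hxp, rfl⟩, he⟩
  have hsplit : ∀ U : Set (BondConfig (Fin n)), μ.real U = μ.real (U \ Nbad) := by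
    intro U
    have h := measureReal_inter_add_sdiff (μ := μ) (s := U) (hmeas Nbad)
    have h0 : μ.real (U ∩ Nbad) = 0 :=
      le_antisymm ((measureReal_mono Set.inter_subset_right).trans hN0.le) measureReal_nonneg
    linarith
  have hdiff : S \ Nbad = T \ Nbad := by
    ext ω
    simp only [Set.mem_sdiff]
    constructor
    · rintro ⟨hS, hω⟩; exact ⟨(hST ω (hgood ω hω)).1 hS, hω⟩
    · rintro ⟨hT, hω⟩; exact ⟨(hST ω (hgood ω hω)).2 hT, hω⟩
  rw [hsplit S, hsplit T, hdiff]

/-! ## The internal law -/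

/-- **`P(X ≥ 1)` of a two-anchor block** (block relays are leaves, a.s. leaf-good weights): with `Eᵢ = {c ↔ vᵢ in core}`,
`Aᵢ = {a ∈ A ∩ Z : par a = vᵢ}`, `Yᵢ = #{ℓ ∈ Aᵢ : s(vᵢ,ℓ) open}`:
`P(X ≥ 1) = P(E₁∖E₂)P(Y₁≥1) + P(E₂∖E₁)P(Y₂≥1) + P(E₁∩E₂)P(Y₁≥1) + P(E₁∩E₂)P(Y₁=0)P(Y₂≥1)`. [this work] -/
theorem real_one_le_X_eq (v : Sym2 (Fin n) → unitInterval)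
    (hv : ∀ ℓ ∈ L, ∀ x : Fin n, x ≠ ℓ → x ≠ par ℓ → (v s(ℓ, x) : ℝ) = 0) {A : Finset (Fin n)} (hA : A ∩ Z ⊆ L) :
    (prodBernoulli v).real {ω | 1 ≤ ((A ∩ Z).filter fun a => onZ Z ω ∈ openConn c a).card} =
      (prodBernoulli v).real ({ω | core Z L ω ∈ openConn c v₁} \ {ω | core Z L ω ∈ openConn c v₂}) *
        (prodBernoulli v).real {ω | 1 ≤ (((A ∩ Z).filter fun a => par a = v₁).filter fun ℓ => s(v₁, ℓ) ∈ ω).card} +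
      (prodBernoulli v).real ({ω | core Z L ω ∈ openConn c v₂} \ {ω | core Z L ω ∈ openConn c v₁}) *
        (prodBernoulli v).real {ω | 1 ≤ (((A ∩ Z).filter fun a => par a = v₂).filter fun ℓ => s(v₂, ℓ) ∈ ω).card} +
      (prodBernoulli v).real ({ω | core Z L ω ∈ openConn c v₁} ∩ {ω | core Z L ω ∈ openConn c v₂}) *
        (prodBernoulli v).real {ω | 1 ≤ (((A ∩ Z).filter fun a => par a = v₁).filter fun ℓ => s(v₁, ℓ) ∈ ω).card} +
      (prodBernoulli v).real ({ω | core Z L ω ∈ openConn c v₁} ∩ {ω | core Z L ω ∈ openConn c v₂}) *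
        (prodBernoulli v).real {ω | (((A ∩ Z).filter fun a => par a = v₁).filter fun ℓ => s(v₁, ℓ) ∈ ω).card = 0} *
        (prodBernoulli v).real {ω | 1 ≤ (((A ∩ Z).filter fun a => par a = v₂).filter fun ℓ => s(v₂, ℓ) ∈ ω).card} := by
  set μ := prodBernoulli v with hμ
  have hmeas : ∀ U : Set (BondConfig (Fin n)), MeasurableSet U := fun U => (Set.toFinite U).measurableSet
  set A₁ := (A ∩ Z).filter fun a => par a = v₁ with hA₁
  set A₂ := (A ∩ Z).filter fun a => par a = v₂ with hA₂
  have hA₁L : A₁ ⊆ L := fun a ha => hA (mem_filter.1 ha).1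
  have hA₂L : A₂ ⊆ L := fun a ha => hA (mem_filter.1 ha).1
  set E₁ := {ω : BondConfig (Fin n) | core Z L ω ∈ openConn c v₁} with hE₁
  set E₂ := {ω : BondConfig (Fin n) | core Z L ω ∈ openConn c v₂} with hE₂
  set S := {ω : BondConfig (Fin n) | 1 ≤ ((A ∩ Z).filter fun a => onZ Z ω ∈ openConn c a).card} with hS
  set G₁ := {ω : BondConfig (Fin n) | 1 ≤ (A₁.filter fun ℓ => s(v₁, ℓ) ∈ ω).card} with hG₁
  set G₂ := {ω : BondConfig (Fin n) | 1 ≤ (A₂.filter fun ℓ => s(v₂, ℓ) ∈ ω).card} with hG₂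
  set Z₁ := {ω : BondConfig (Fin n) | (A₁.filter fun ℓ => s(v₁, ℓ) ∈ ω).card = 0} with hZ₁
  -- the count on leaf-good configurations
  have hX : ∀ ω, GoodL L par ω → ((A ∩ Z).filter fun a => onZ Z ω ∈ openConn c a).card =
      (if ω ∈ E₁ then (A₁.filter fun ℓ => s(v₁, ℓ) ∈ ω).card else 0) +
      (if ω ∈ E₂ then (A₂.filter fun ℓ => s(v₂, ℓ) ∈ ω).card else 0) := fun ω hω => card_on_eq_twoAnchor H hω hA
  -- determinacy
  have hdE : ∀ (P : Prop → Prop → Prop), DeterminedBy {ω | P (ω ∈ E₁) (ω ∈ E₂)} (↑(corePairs Z L) : Set (Sym2 (Fin n))) :=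
    fun P => determinedBy_core Z L fun η => P (η ∈ openConn c v₁) (η ∈ openConn c v₂)
  have hdG₁ : DeterminedBy G₁ (↑(hairPairs v₁ A₁) : Set (Sym2 (Fin n))) := determinedBy_hair v₁ A₁ fun k => 1 ≤ k
  have hdG₂ : DeterminedBy G₂ (↑(hairPairs v₂ A₂) : Set (Sym2 (Fin n))) := determinedBy_hair v₂ A₂ fun k => 1 ≤ k
  have hdZ₁ : DeterminedBy Z₁ (↑(hairPairs v₁ A₁) : Set (Sym2 (Fin n))) := determinedBy_hair v₁ A₁ fun k => k = 0
  -- splits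
  have s1 := measureReal_inter_add_sdiff (μ := μ) (s := S) (hmeas E₁)
  have s2 := measureReal_inter_add_sdiff (μ := μ) (s := S ∩ E₁) (hmeas E₂)
  have s3 := measureReal_inter_add_sdiff (μ := μ) (s := S \ E₁) (hmeas E₂)
  have s4 := measureReal_inter_add_sdiff (μ := μ) (s := S ∩ E₁ ∩ E₂) (hmeas G₁)
  -- identification of the pieces on leaf-good configurations
  have p1 : μ.real ((S ∩ E₁) \ E₂) = μ.real ({ω | ω ∈ E₁ ∧ ¬ ω ∈ E₂} ∩ G₁) := by
    refine real_congr_of_goodL v hv _ _ fun ω hω => ?_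
    simp only [Set.mem_sdiff, Set.mem_inter_iff, mem_setOf_eq, hS, hG₁]
    rw [hX ω hω]
    by_cases h1 : ω ∈ E₁ <;> by_cases h2 : ω ∈ E₂ <;>
      simp only [h1, h2, if_true, if_false, true_and, and_true, false_and, and_false, not_true_eq_false, not_false_eq_true, add_zero, zero_add]
  have p2 : μ.real ((S \ E₁) ∩ E₂) = μ.real ({ω | ω ∈ E₂ ∧ ¬ ω ∈ E₁} ∩ G₂) := by
    refine real_congr_of_goodL v hv _ _ fun ω hω => ?_
    simp only [Set.mem_sdiff, Set.mem_inter_iff, mem_setOf_eq, hS, hG₂]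
    rw [hX ω hω]
    by_cases h1 : ω ∈ E₁ <;> by_cases h2 : ω ∈ E₂ <;>
      simp only [h1, h2, if_true, if_false, true_and, and_true, false_and, and_false, not_true_eq_false, not_false_eq_true, add_zero, zero_add]
  have p3 : μ.real ((S \ E₁) \ E₂) = 0 := by
    have : μ.real ((S \ E₁) \ E₂) = μ.real (∅ : Set (BondConfig (Fin n))) := by
      refine real_congr_of_goodL v hv _ _ fun ω hω => ?_
      simp only [Set.mem_sdiff, mem_setOf_eq, hS, Set.mem_empty_iff_false, iff_false]
      rw [hX ω hω]
      by_cases h1 : ω ∈ E₁ <;> by_cases h2 : ω ∈ E₂ <;>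
        simp only [h1, h2, if_true, if_false, and_true, and_false, not_true_eq_false, not_false_eq_true, add_zero, zero_add, not_le]
      omega
    rw [this, measureReal_empty]
  have p4 : μ.real (S ∩ E₁ ∩ E₂ ∩ G₁) = μ.real ({ω | ω ∈ E₁ ∧ ω ∈ E₂} ∩ G₁) := by
    refine real_congr_of_goodL v hv _ _ fun ω hω => ?_
    simp only [Set.mem_inter_iff, mem_setOf_eq, hS, hG₁]
    rw [hX ω hω]
    by_cases h1 : ω ∈ E₁ <;> by_cases h2 : ω ∈ E₂ <;>
      simp only [h1, h2, if_true, if_false, true_and, and_true, false_and, and_false, add_zero, zero_add]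
    omega
  have p5 : μ.real ((S ∩ E₁ ∩ E₂) \ G₁) = μ.real ({ω | ω ∈ E₁ ∧ ω ∈ E₂} ∩ Z₁ ∩ G₂) := by
    refine real_congr_of_goodL v hv _ _ fun ω hω => ?_
    simp only [Set.mem_sdiff, Set.mem_inter_iff, mem_setOf_eq, hS, hG₁, hZ₁, hG₂]
    rw [hX ω hω]
    by_cases h1 : ω ∈ E₁ <;> by_cases h2 : ω ∈ E₂ <;>
      simp only [h1, h2, if_true, if_false, true_and, and_true, false_and, and_false, add_zero, zero_add, not_le]
    omega
  -- independence
  rw [real_core_hair v hA₁L v₁ (hdE fun a b => a ∧ ¬ b) hdG₁] at p1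
  rw [real_core_hair v hA₂L v₂ (hdE fun a b => b ∧ ¬ a) hdG₂] at p2
  rw [real_core_hair v hA₁L v₁ (hdE fun a b => a ∧ b) hdG₁] at p4
  rw [real_core_hair_hair H v hA₁L hA₂L (hdE fun a b => a ∧ b) hdZ₁ hdG₂] at p5
  -- the pattern events as differences / intersections
  have e10 : {ω : BondConfig (Fin n) | ω ∈ E₁ ∧ ¬ ω ∈ E₂} = E₁ \ E₂ := rfl
  have e01 : {ω : BondConfig (Fin n) | ω ∈ E₂ ∧ ¬ ω ∈ E₁} = E₂ \ E₁ := rfl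
  have e11 : {ω : BondConfig (Fin n) | ω ∈ E₁ ∧ ω ∈ E₂} = E₁ ∩ E₂ := rfl
  rw [e10] at p1; rw [e01] at p2; rw [e11] at p4 p5
  linarith [s1, s2, s3, s4, p1, p2, p3, p4, p5]

/-- **`P(X ≥ 2)` of a two-anchor block**:
`P(X ≥ 2) = P(E₁∖E₂)P(Y₁≥2) + P(E₂∖E₁)P(Y₂≥2) + P(E₁∩E₂)P(Y₁≥2) + P(E₁∩E₂)P(Y₁=1)P(Y₂≥1) + P(E₁∩E₂)P(Y₁=0)P(Y₂≥2)`. [this work] -/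
theorem real_two_le_X_eq (v : Sym2 (Fin n) → unitInterval)
    (hv : ∀ ℓ ∈ L, ∀ x : Fin n, x ≠ ℓ → x ≠ par ℓ → (v s(ℓ, x) : ℝ) = 0) {A : Finset (Fin n)} (hA : A ∩ Z ⊆ L) :
    (prodBernoulli v).real {ω | 2 ≤ ((A ∩ Z).filter fun a => onZ Z ω ∈ openConn c a).card} =
      (prodBernoulli v).real ({ω | core Z L ω ∈ openConn c v₁} \ {ω | core Z L ω ∈ openConn c v₂}) *
        (prodBernoulli v).real {ω | 2 ≤ (((A ∩ Z).filter fun a => par a = v₁).filter fun ℓ => s(v₁, ℓ) ∈ ω).card} +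
      (prodBernoulli v).real ({ω | core Z L ω ∈ openConn c v₂} \ {ω | core Z L ω ∈ openConn c v₁}) *
        (prodBernoulli v).real {ω | 2 ≤ (((A ∩ Z).filter fun a => par a = v₂).filter fun ℓ => s(v₂, ℓ) ∈ ω).card} +
      (prodBernoulli v).real ({ω | core Z L ω ∈ openConn c v₁} ∩ {ω | core Z L ω ∈ openConn c v₂}) *
        (prodBernoulli v).real {ω | 2 ≤ (((A ∩ Z).filter fun a => par a = v₁).filter fun ℓ => s(v₁, ℓ) ∈ ω).card} +
      (prodBernoulli v).real ({ω | core Z L ω ∈ openConn c v₁} ∩ {ω | core Z L ω ∈ openConn c v₂}) *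
        (prodBernoulli v).real {ω | (((A ∩ Z).filter fun a => par a = v₁).filter fun ℓ => s(v₁, ℓ) ∈ ω).card = 1} *
        (prodBernoulli v).real {ω | 1 ≤ (((A ∩ Z).filter fun a => par a = v₂).filter fun ℓ => s(v₂, ℓ) ∈ ω).card} +
      (prodBernoulli v).real ({ω | core Z L ω ∈ openConn c v₁} ∩ {ω | core Z L ω ∈ openConn c v₂}) *
        (prodBernoulli v).real {ω | (((A ∩ Z).filter fun a => par a = v₁).filter fun ℓ => s(v₁, ℓ) ∈ ω).card = 0} *
        (prodBernoulli v).real {ω | 2 ≤ (((A ∩ Z).filter fun a => par a = v₂).filter fun ℓ => s(v₂, ℓ) ∈ ω).card} := by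
  set μ := prodBernoulli v with hμ
  have hmeas : ∀ U : Set (BondConfig (Fin n)), MeasurableSet U := fun U => (Set.toFinite U).measurableSet
  set A₁ := (A ∩ Z).filter fun a => par a = v₁ with hA₁
  set A₂ := (A ∩ Z).filter fun a => par a = v₂ with hA₂
  have hA₁L : A₁ ⊆ L := fun a ha => hA (mem_filter.1 ha).1
  have hA₂L : A₂ ⊆ L := fun a ha => hA (mem_filter.1 ha).1
  set E₁ := {ω : BondConfig (Fin n) | core Z L ω ∈ openConn c v₁} with hE₁
  set E₂ := {ω : BondConfig (Fin n) | core Z L ω ∈ openConn c v₂} with hE₂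
  set S := {ω : BondConfig (Fin n) | 2 ≤ ((A ∩ Z).filter fun a => onZ Z ω ∈ openConn c a).card} with hS
  set D₁ := {ω : BondConfig (Fin n) | 2 ≤ (A₁.filter fun ℓ => s(v₁, ℓ) ∈ ω).card} with hD₁
  set D₂ := {ω : BondConfig (Fin n) | 2 ≤ (A₂.filter fun ℓ => s(v₂, ℓ) ∈ ω).card} with hD₂
  set G₂ := {ω : BondConfig (Fin n) | 1 ≤ (A₂.filter fun ℓ => s(v₂, ℓ) ∈ ω).card} with hG₂
  set O₁ := {ω : BondConfig (Fin n) | (A₁.filter fun ℓ => s(v₁, ℓ) ∈ ω).card = 1} with hO₁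
  set Z₁ := {ω : BondConfig (Fin n) | (A₁.filter fun ℓ => s(v₁, ℓ) ∈ ω).card = 0} with hZ₁
  have hX : ∀ ω, GoodL L par ω → ((A ∩ Z).filter fun a => onZ Z ω ∈ openConn c a).card =
      (if ω ∈ E₁ then (A₁.filter fun ℓ => s(v₁, ℓ) ∈ ω).card else 0) +
      (if ω ∈ E₂ then (A₂.filter fun ℓ => s(v₂, ℓ) ∈ ω).card else 0) := fun ω hω => card_on_eq_twoAnchor H hω hA
  have hdE : ∀ (P : Prop → Prop → Prop), DeterminedBy {ω | P (ω ∈ E₁) (ω ∈ E₂)} (↑(corePairs Z L) : Set (Sym2 (Fin n))) :=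
    fun P => determinedBy_core Z L fun η => P (η ∈ openConn c v₁) (η ∈ openConn c v₂)
  have hdD₁ : DeterminedBy D₁ (↑(hairPairs v₁ A₁) : Set (Sym2 (Fin n))) := determinedBy_hair v₁ A₁ fun k => 2 ≤ k
  have hdD₂ : DeterminedBy D₂ (↑(hairPairs v₂ A₂) : Set (Sym2 (Fin n))) := determinedBy_hair v₂ A₂ fun k => 2 ≤ k
  have hdG₂ : DeterminedBy G₂ (↑(hairPairs v₂ A₂) : Set (Sym2 (Fin n))) := determinedBy_hair v₂ A₂ fun k => 1 ≤ k
  have hdO₁ : DeterminedBy O₁ (↑(hairPairs v₁ A₁) : Set (Sym2 (Fin n))) := determinedBy_hair v₁ A₁ fun k => k = 1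
  have hdZ₁ : DeterminedBy Z₁ (↑(hairPairs v₁ A₁) : Set (Sym2 (Fin n))) := determinedBy_hair v₁ A₁ fun k => k = 0
  -- splits
  have s1 := measureReal_inter_add_sdiff (μ := μ) (s := S) (hmeas E₁)
  have s2 := measureReal_inter_add_sdiff (μ := μ) (s := S ∩ E₁) (hmeas E₂)
  have s3 := measureReal_inter_add_sdiff (μ := μ) (s := S \ E₁) (hmeas E₂)
  have s4 := measureReal_inter_add_sdiff (μ := μ) (s := S ∩ E₁ ∩ E₂) (hmeas D₁)
  have s5 := measureReal_inter_add_sdiff (μ := μ) (s := (S ∩ E₁ ∩ E₂) \ D₁) (hmeas O₁)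
  -- pieces
  have p1 : μ.real ((S ∩ E₁) \ E₂) = μ.real ({ω | ω ∈ E₁ ∧ ¬ ω ∈ E₂} ∩ D₁) := by
    refine real_congr_of_goodL v hv _ _ fun ω hω => ?_
    simp only [Set.mem_sdiff, Set.mem_inter_iff, mem_setOf_eq, hS, hD₁]
    rw [hX ω hω]
    by_cases h1 : ω ∈ E₁ <;> by_cases h2 : ω ∈ E₂ <;>
      simp only [h1, h2, if_true, if_false, true_and, and_true, false_and, and_false, not_true_eq_false, not_false_eq_true, add_zero, zero_add]
  have p2 : μ.real ((S \ E₁) ∩ E₂) = μ.real ({ω | ω ∈ E₂ ∧ ¬ ω ∈ E₁} ∩ D₂) := by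
    refine real_congr_of_goodL v hv _ _ fun ω hω => ?_
    simp only [Set.mem_sdiff, Set.mem_inter_iff, mem_setOf_eq, hS, hD₂]
    rw [hX ω hω]
    by_cases h1 : ω ∈ E₁ <;> by_cases h2 : ω ∈ E₂ <;>
      simp only [h1, h2, if_true, if_false, true_and, and_true, false_and, and_false, not_true_eq_false, not_false_eq_true, add_zero, zero_add]
  have p3 : μ.real ((S \ E₁) \ E₂) = 0 := by
    have : μ.real ((S \ E₁) \ E₂) = μ.real (∅ : Set (BondConfig (Fin n))) := by
      refine real_congr_of_goodL v hv _ _ fun ω hω => ?_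
      simp only [Set.mem_sdiff, mem_setOf_eq, hS, Set.mem_empty_iff_false, iff_false]
      rw [hX ω hω]
      by_cases h1 : ω ∈ E₁ <;> by_cases h2 : ω ∈ E₂ <;>
        simp only [h1, h2, if_true, if_false, and_true, and_false, not_true_eq_false, not_false_eq_true, add_zero, zero_add, not_le]
      omega
    rw [this, measureReal_empty]
  have p4 : μ.real (S ∩ E₁ ∩ E₂ ∩ D₁) = μ.real ({ω | ω ∈ E₁ ∧ ω ∈ E₂} ∩ D₁) := by
    refine real_congr_of_goodL v hv _ _ fun ω hω => ?_
    simp only [Set.mem_inter_iff, mem_setOf_eq, hS, hD₁]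
    rw [hX ω hω]
    by_cases h1 : ω ∈ E₁ <;> by_cases h2 : ω ∈ E₂ <;>
      simp only [h1, h2, if_true, if_false, true_and, and_true, false_and, and_false, add_zero, zero_add]
    omega
  have p5 : μ.real (((S ∩ E₁ ∩ E₂) \ D₁) ∩ O₁) = μ.real ({ω | ω ∈ E₁ ∧ ω ∈ E₂} ∩ O₁ ∩ G₂) := by
    refine real_congr_of_goodL v hv _ _ fun ω hω => ?_
    simp only [Set.mem_sdiff, Set.mem_inter_iff, mem_setOf_eq, hS, hD₁, hO₁, hG₂]
    rw [hX ω hω]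
    by_cases h1 : ω ∈ E₁ <;> by_cases h2 : ω ∈ E₂ <;>
      simp only [h1, h2, if_true, if_false, true_and, and_true, false_and, and_false, add_zero, zero_add, not_le]
    omega
  have p6 : μ.real (((S ∩ E₁ ∩ E₂) \ D₁) \ O₁) = μ.real ({ω | ω ∈ E₁ ∧ ω ∈ E₂} ∩ Z₁ ∩ D₂) := by
    refine real_congr_of_goodL v hv _ _ fun ω hω => ?_
    simp only [Set.mem_sdiff, Set.mem_inter_iff, mem_setOf_eq, hS, hD₁, hO₁, hZ₁, hD₂]
    rw [hX ω hω]
    by_cases h1 : ω ∈ E₁ <;> by_cases h2 : ω ∈ E₂ <;>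
      simp only [h1, h2, if_true, if_false, true_and, and_true, false_and, and_false, add_zero, zero_add, not_le]
    omega
  rw [real_core_hair v hA₁L v₁ (hdE fun a b => a ∧ ¬ b) hdD₁] at p1
  rw [real_core_hair v hA₂L v₂ (hdE fun a b => b ∧ ¬ a) hdD₂] at p2
  rw [real_core_hair v hA₁L v₁ (hdE fun a b => a ∧ b) hdD₁] at p4
  rw [real_core_hair_hair H v hA₁L hA₂L (hdE fun a b => a ∧ b) hdO₁ hdG₂] at p5
  rw [real_core_hair_hair H v hA₁L hA₂L (hdE fun a b => a ∧ b) hdZ₁ hdD₂] at p6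
  have e10 : {ω : BondConfig (Fin n) | ω ∈ E₁ ∧ ¬ ω ∈ E₂} = E₁ \ E₂ := rfl
  have e01 : {ω : BondConfig (Fin n) | ω ∈ E₂ ∧ ¬ ω ∈ E₁} = E₂ \ E₁ := rfl
  have e11 : {ω : BondConfig (Fin n) | ω ∈ E₁ ∧ ω ∈ E₂} = E₁ ∩ E₂ := rfl
  rw [e10] at p1; rw [e01] at p2; rw [e11] at p4 p5 p6
  linarith [s1, s2, s3, s4, s5, p1, p2, p3, p4, p5, p6]

end TwoAnchor

end Block

end Quant

end Summit.CriticalPhenomena.PercolationContinuityZ3.Theorems
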